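import Mathlib
import HarnessLib

/-!
# X11b at `p = 3` (cell `bsd-stepL`, seat `bsd-stepL-koly`): the linear algebra of UNIPOTENT-ADMISSIBLE
# auxiliary primes — the substitute, at `p = 3`, for Bertolini–Darmon admissible primes

HONEST FRAMING (cell `bsd-stepL`, FULL-BSD rank ≤ 1 programme D-0033 tranche 1a, memo
`run/shared/lean/pub/bsd-stepL/koly/MEMO-v0.md` §4): elementary THEOREMS about one endomorphism of a
plane; no named fact, no `sorry`, nothing about elliptic curves is asserted; nothing is booked. They
are the kernel-checked core of Lemmas U1–U4 of the memo, which repair the definition-level void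
"K1" of `cells/x11b3/LINE-K.md` (team x11b3, 2026-08-21): the auxiliary *admissible primes* of the
level-raising architecture for Kolyvagin's conjecture (Bertolini–Darmon, Ann. of Math. 162 (2005)
p. 18; W. Zhang, Camb. J. Math. 2 (2014) Notations (xiv); tree
`Literature.NumberTheory.EllipticCurves.BertoliniDarmon2005.IsAdmissiblePrime`,
`not_isAdmissiblePrime_of_p_eq_three`) require `p ∤ q² − 1` and do not exist at `p = 3`.

## The dictionary (memo §4; `q` a prime, `q ∤ 3N d_K`, `q` inert in `K`, `V = E[3]`)

What the three printed uses of `p ∤ q² − 1` consume is that `Frob_q` acting on `V` through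
`φ := ρ̄(Frob_q)` has, over `K_q` (where Frobenius is `F = φ²`), a ONE-dimensional fixed space. At
`p = 3` a semisimple `φ` has `φ²` scalar (`q² ≡ 1`), so this happens iff `φ = δ·u` with `δ = ±1` and
`u` unipotent, `u ≠ 1` — "unipotent-admissible". Writing `N = u − 1` (`N² = 0`, `N ≠ 0`,
`dim V = 2`):
* `range N = ker N =: ℓ`, a line (`range_sub_one_eq_ker`, `finrank_ker_sub_one_eq_one`) — so
  `H¹_fin(K_q, V) = V/(F − 1)V = V/ℓ` and `H¹_sing(K_q, V) = Hom(I_q^t, V)^F = Hom(ℤ/3(1), ker(F−1)) = ℓ(−1)`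
  are lines, because `F − 1 = u² − 1 = 2N` has the same kernel and range as `N`
  (`mul_self_sub_one_eq`, `ker_mul_self_sub_one_eq`, `range_mul_self_sub_one_eq`): Bertolini–Darmon's
  Lemma 2.6 at a unipotent-admissible prime (memo U1);
* `ℓ` is the ONLY `u`-stable line (`eq_ker_of_finrank_eq_one_of_invariant`): BD05 Assumption 2.1
  ("a unique one-dimensional subspace on which `Gal(ℚ̄_q/ℚ_q)` acts via `±ε`") holds verbatim, and
  `φ` is not a scalar = Helm 2007 Def. 6.4 (controllable ⇒ multiplicity one, Cor. 8.11) (memo U2);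
* `1 + u` is invertible while `range (1 − u) = ℓ` (`isUnit_one_add`, `range_one_sub_eq_ker`): for a
  global class `c` in the `ν`-eigenspace of complex conjugation and `Frob_q = (v, (τ, δu))` in
  `V ⋊ Gal(K(E[3])/ℚ)`, `loc_q(c) = (1 + νδ·u)v mod ℓ`, which can be made non-zero by Čebotarev iff
  `νδ = +1` — the sign rule of BD05 Thm. 3.2 / W. Zhang Lemma 7.3 at `p = 3` (memo U3);
* the connecting map of `0 → ℓ → V → V/ℓ → 0` over `K_q` is non-zero since `F = u² ≠ 1`
  (`mul_self_ne_one`), so the level-raised local condition `Im(H¹(K_q, ℓ) → H¹(K_q, V))` is a line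
  transverse to `H¹_fin` (memo U4).
Everything is stated for an endomorphism `u` of a finite-dimensional vector space over a field `k`
with `(u − 1)² = 0`; `char k ≠ 2` where needed (at `p = 3`, `k = 𝔽₃`).

## References

* M. Bertolini, H. Darmon, Ann. of Math. 162 (2005): p. 18 (admissible primes, Lemma 2.6), p. 14
  (Assumption 2.1, Remark 1), p. 22 (Thm. 3.2, "here the assumption that p > 3 is needed").
  [BertoliniDarmon2005]
* W. Zhang, Camb. J. Math. 2 (2014): Notations (xiv), Lemma 3.3, Def. 4.1, Prop. 5.4, Lemma 7.3.
  [WZhang2014]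
* D. Helm, *On maps between modular Jacobians and Jacobians of Shimura curves*, Israel J. Math. 160
  (2007) = arXiv:math/0401265: Def. 6.4, Cor. 8.11, §9 (no bib key yet; cited in prose only).
-/

namespace Summit.BirchSwinnertonDyer.Rank1Residual.X11b.Three.UAdm

open Module LinearMap

section CommRing

variable {k : Type*} [CommRing k] {V : Type*} [AddCommGroup V] [Module k V] (u : Module.End k V)

/-- `range (u − 1) ≤ ker (u − 1)` when `(u − 1)² = 0`. [folklore] -/
theorem range_sub_one_le_ker (hu : (u - 1) * (u - 1) = 0) :
    LinearMap.range (u - 1) ≤ LinearMap.ker (u - 1) :=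
  LinearMap.range_le_ker_iff.mpr hu

/-- **`u² − 1 = 2(u − 1)`** for `(u − 1)² = 0`: over `K_q` the Frobenius `F = Frob_q² = u²` of a
unipotent-admissible prime satisfies `F − 1 = 2·(u − 1)`. [folklore] -/
theorem mul_self_sub_one_eq (hu : (u - 1) * (u - 1) = 0) : u * u - 1 = 2 * (u - 1) := by
  have h : u * u - 1 = 2 * (u - 1) + (u - 1) * (u - 1) := by noncomm_ring
  rw [h, hu, add_zero]

/-- **`1 + u` is a unit** when `(u − 1)² = 0` and `2` is invertible in `k`: explicitly
`(1 + u)(3 − u) = (3 − u)(1 + u) = 4`. This is the case `νδ = +1` of the sign rule (memo U3): the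
localisation `(1 + u)v` runs over all of `V` with `v`. [folklore] -/
theorem isUnit_one_add (hu : (u - 1) * (u - 1) = 0) (h2 : IsUnit (2 : k)) : IsUnit (1 + u) := by
  have hN : IsNilpotent (u - 1) := ⟨2, by rw [pow_two, hu]⟩
  have h2' : IsUnit (algebraMap k (Module.End k V) 2) := h2.map _
  have hcomm : Commute (u - 1) (algebraMap k (Module.End k V) 2) := (Algebra.commutes 2 (u - 1)).symm
  have h := hN.isUnit_add_left_of_commute h2' hcomm
  have heq : algebraMap k (Module.End k V) 2 + (u - 1) = 1 + u := by
    ext v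
    simp [two_smul]
  rwa [heq] at h

/-- `range (1 − u) = range (u − 1)`: the case `νδ = −1` of the sign rule lands in the line
`range (u − 1)` (= `ker (u − 1)` in the plane, `range_one_sub_eq_ker`). [folklore] -/
theorem range_one_sub (u : Module.End k V) : LinearMap.range (1 - u) = LinearMap.range (u - 1) := by
  rw [← neg_sub, LinearMap.range_neg]

/-- `u² ≠ 1` when `(u − 1)² = 0`, `u ≠ 1` and `2` is not a zero divisor on `End V` (e.g. `k` a field
of characteristic `≠ 2`): over `K_q` the Frobenius `F = u²` of a unipotent-admissible prime is NOT
trivial, so `0 → ℓ → V → V/ℓ → 0` does not split over `K_q` (memo U4). [folklore] -/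
theorem mul_self_ne_one (hu : (u - 1) * (u - 1) = 0) (hne : u ≠ 1)
    (h2 : ∀ f : Module.End k V, 2 * f = 0 → f = 0) : u * u ≠ 1 := by
  intro h
  have h0 : 2 * (u - 1) = 0 := by rw [← mul_self_sub_one_eq u hu, h, sub_self]
  exact hne (sub_eq_zero.mp (h2 _ h0))

end CommRing

section Field

variable {k : Type*} [Field k] {V : Type*} [AddCommGroup V] [Module k V] [FiniteDimensional k V]
  (u : Module.End k V)

/-- **The fixed space of a non-trivial unipotent endomorphism of a plane is a line**:
`dim ker (u − 1) = 1` for `(u − 1)² = 0`, `u ≠ 1`, `dim V = 2` (rank–nullity with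
`range ≤ ker`). At a unipotent-admissible prime: `dim E[3]^{Frob_q = δ} = 1`. [folklore] -/
theorem finrank_ker_sub_one_eq_one (hu : (u - 1) * (u - 1) = 0) (hne : u ≠ 1)
    (h2 : finrank k V = 2) : finrank k (LinearMap.ker (u - 1)) = 1 := by
  have hrk := LinearMap.finrank_range_add_finrank_ker (u - 1)
  have hle : finrank k (LinearMap.range (u - 1)) ≤ finrank k (LinearMap.ker (u - 1)) :=
    Submodule.finrank_mono (range_sub_one_le_ker u hu)
  have hpos : finrank k (LinearMap.range (u - 1)) ≠ 0 := fun h0 ↦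
    hne (sub_eq_zero.mp (LinearMap.range_eq_bot.mp (Submodule.finrank_eq_zero.mp h0)))
  omega

/-- **`range (u − 1) = ker (u − 1)`** in the plane (both are the line `ℓ`): so
`H¹_fin(K_q, E[3]) = E[3]/(F−1)E[3] = E[3]/ℓ` is a line (memo U1, first half). [folklore] -/
theorem range_sub_one_eq_ker (hu : (u - 1) * (u - 1) = 0) (hne : u ≠ 1) (h2 : finrank k V = 2) :
    LinearMap.range (u - 1) = LinearMap.ker (u - 1) := by
  apply Submodule.eq_of_le_of_finrank_eq (range_sub_one_le_ker u hu)
  have hrk := LinearMap.finrank_range_add_finrank_ker (u - 1)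
  have hk := finrank_ker_sub_one_eq_one u hu hne h2
  omega

/-- `range (1 − u) = ker (u − 1)`: the `νδ = −1` localisations die in `H¹_fin = V/ℓ` (memo U3).
[folklore] -/
theorem range_one_sub_eq_ker (hu : (u - 1) * (u - 1) = 0) (hne : u ≠ 1) (h2 : finrank k V = 2) :
    LinearMap.range (1 - u) = LinearMap.ker (u - 1) := by
  rw [range_one_sub, range_sub_one_eq_ker u hu hne h2]

omit [FiniteDimensional k V] in
/-- **`ker (u² − 1) = ker (u − 1)`** in characteristic `≠ 2`: `H¹_sing(K_q, E[3^M]) =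
Hom(ℤ/3^M(1), ker(F − 1))`, `F = u²`, is the line `ℓ(−1)` (memo U1, second half; BD05 Lemma 2.6).
[folklore] -/
theorem ker_mul_self_sub_one_eq (hu : (u - 1) * (u - 1) = 0) (h2 : (2 : k) ≠ 0) :
    LinearMap.ker (u * u - 1) = LinearMap.ker (u - 1) := by
  rw [mul_self_sub_one_eq u hu, show (2 : Module.End k V) * (u - 1) = (2 : k) • (u - 1) by
    rw [Algebra.smul_def, map_ofNat], LinearMap.ker_smul _ _ h2]

omit [FiniteDimensional k V] in
/-- **`range (u² − 1) = range (u − 1)`** in characteristic `≠ 2`: `(F − 1)V = ℓ`, so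
`H¹_fin(K_q, V) = V/ℓ` (memo U1). [folklore] -/
theorem range_mul_self_sub_one_eq (hu : (u - 1) * (u - 1) = 0) (h2 : (2 : k) ≠ 0) :
    LinearMap.range (u * u - 1) = LinearMap.range (u - 1) := by
  rw [mul_self_sub_one_eq u hu, show (2 : Module.End k V) * (u - 1) = (2 : k) • (u - 1) by
    rw [Algebra.smul_def, map_ofNat], LinearMap.range_smul _ _ h2]

/-- **Uniqueness of the stable line** (BD05 Assumption 2.1 at a unipotent-admissible prime; the
"not a scalar" clause of Helm 2007 Def. 6.4): a `u`-stable LINE `W ≤ V` equals `ker (u − 1)` — on a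
line the nilpotent `u − 1` acts by a scalar `c` with `c² = 0`, so by `0`. (memo U2) [folklore] -/
theorem eq_ker_of_finrank_eq_one_of_invariant (hu : (u - 1) * (u - 1) = 0) (hne : u ≠ 1)
    (h2 : finrank k V = 2) (W : Submodule k V) (hW : finrank k W = 1)
    (hinv : ∀ w ∈ W, u w ∈ W) : W = LinearMap.ker (u - 1) := by
  -- `u - 1` preserves `W`
  have hinv' : ∀ w ∈ W, (u - 1) w ∈ W := fun w hw ↦ by
    simpa using W.sub_mem (hinv w hw) hw
  -- a generator of `W`
  obtain ⟨w₀, hw₀⟩ := finrank_eq_one_iff'.mp hW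
  obtain ⟨hw₀ne, hgen⟩ := hw₀
  -- `(u - 1) w₀ = c • w₀`
  obtain ⟨c, hc⟩ := hgen ⟨(u - 1) w₀, hinv' w₀ w₀.2⟩
  have hc' : (u - 1) (w₀ : V) = c • (w₀ : V) := by
    have := congrArg Subtype.val hc
    simpa using this.symm
  -- `c² w₀ = (u-1)² w₀ = 0`
  have hcc : (c * c) • (w₀ : V) = 0 := by
    have h0 : ((u - 1) * (u - 1)) (w₀ : V) = 0 := by rw [hu]; rfl
    rw [Module.End.mul_apply, hc', map_smul, hc', smul_smul] at h0
    exact h0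
  have hw₀V : (w₀ : V) ≠ 0 := fun h ↦ hw₀ne (Subtype.ext h)
  have hc0 : c = 0 := by
    have := smul_eq_zero.mp hcc
    rcases this with h | h
    · exact mul_self_eq_zero.mp h
    · exact absurd h hw₀V
  -- hence `W ≤ ker (u - 1)`
  have hle : W ≤ LinearMap.ker (u - 1) := by
    intro w hw
    obtain ⟨a, ha⟩ := hgen ⟨w, hw⟩
    have haw : (w : V) = a • (w₀ : V) := by
      have := congrArg Subtype.val ha
      simpa using this.symm
    rw [LinearMap.mem_ker, haw, map_smul, hc', hc0, zero_smul, smul_zero]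
  exact Submodule.eq_of_le_of_finrank_eq hle (by rw [hW, finrank_ker_sub_one_eq_one u hu hne h2])

end Field


/-! ### U5 — the level-raising congruence module at a unipotent-admissible prime
(Bertolini–Darmon 2005, proof of Thm. 5.15, p. 48: on `X_ℓ² / I_f ≅ (ℤ/pⁿ)²` the operator `U_ℓ`
acts by a `2 × 2` matrix `A` with `tr A = t_ℓ ≡ ε(ℓ+1)` and `det A = ℓ`; they conclude, "with the
fact that p ≥ 5", that `U_ℓ + ε` is invertible and `coker(U_ℓ − ε) ≅ ℤ/pⁿ`). The two determinant
identities below show what is really used: `det(A − ε) = 0` always, and `det(A + ε) = 2(ℓ+1)` — a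
unit iff `p` is odd and `p ∤ ℓ + 1`; at a unipotent-admissible prime (`ℓ ≡ 1 (mod pⁿ)`) this is
`p ∤ 4`, fine at `p = 3`. The remaining input, `coker(A − ε)` CYCLIC, is "`A − ε` has a unit entry",
i.e. `A mod p` non-scalar — the non-scalarity clause of unipotent-admissibility again (memo
`koly/G1G2-PLAN.md` §F; the Smith-form statement is recorded there in prose). -/

section HeckeModule

variable {R : Type*} [CommRing R]

/-- `det(A − e·1) = det A − e·tr A + e²` for a `2 × 2` matrix. [folklore] -/
theorem det_sub_smul_one_fin_two (A : Matrix (Fin 2) (Fin 2) R) (e : R) :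
    (A - e • (1 : Matrix (Fin 2) (Fin 2) R)).det = A.det - e * A.trace + e ^ 2 := by
  simp [Matrix.det_fin_two, Matrix.trace_fin_two]
  ring

/-- `det(A + e·1) = det A + e·tr A + e²` for a `2 × 2` matrix. [folklore] -/
theorem det_add_smul_one_fin_two (A : Matrix (Fin 2) (Fin 2) R) (e : R) :
    (A + e • (1 : Matrix (Fin 2) (Fin 2) R)).det = A.det + e * A.trace + e ^ 2 := by
  simp [Matrix.det_fin_two, Matrix.trace_fin_two]
  ring

/-- **U5 (a): `det(U_ℓ − ε) = 0`** on the `ℓ`-old plane: for `A` with `det A = ℓ`,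
`tr A = ε(ℓ+1)`, `ε² = 1` (the level-raising congruence `t_ℓ ≡ ε(ℓ+1)`, Bertolini–Darmon 2005
p. 48), `det(A − ε) = ℓ − ε²(ℓ+1) + ε² = 0`. No condition on `ℓ mod p`.
[cite: BertoliniDarmon2005, proof of Thm. 5.15 (p. 48)] -/
theorem det_sub_eq_zero_of_levelRaising (A : Matrix (Fin 2) (Fin 2) R) {ε ℓ : R}
    (hε : ε ^ 2 = 1) (htr : A.trace = ε * (ℓ + 1)) (hdet : A.det = ℓ) :
    (A - ε • (1 : Matrix (Fin 2) (Fin 2) R)).det = 0 := by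
  rw [det_sub_smul_one_fin_two, htr, hdet]
  linear_combination (-ℓ) * hε

/-- **U5 (b): `det(U_ℓ + ε) = 2(ℓ+1)`** under the same congruence: so `U_ℓ + ε` is invertible iff
`2(ℓ+1)` is a unit — for Bertolini–Darmon's admissible `ℓ` (`p ∤ ℓ² − 1`) this is "`p` odd" (their
"p ≥ 5"), and for a unipotent-admissible `ℓ ≡ 1 (mod pⁿ)` it is `p ∤ 4`, true at `p = 3`.
[cite: BertoliniDarmon2005, proof of Thm. 5.15 (p. 48)] -/
theorem det_add_eq_of_levelRaising (A : Matrix (Fin 2) (Fin 2) R) {ε ℓ : R}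
    (hε : ε ^ 2 = 1) (htr : A.trace = ε * (ℓ + 1)) (hdet : A.det = ℓ) :
    (A + ε • (1 : Matrix (Fin 2) (Fin 2) R)).det = 2 * (ℓ + 1) := by
  rw [det_add_smul_one_fin_two, htr, hdet]
  linear_combination (ℓ + 2) * hε


/-- For a `2 × 2` matrix with `det B = 0`, the `2 × 2` "minors through row `i`" vanish:
`B i j · B k j' = B i j' · B k j` for all `j', k`. [folklore] -/
theorem mul_eq_mul_of_det_fin_two_eq_zero (B : Matrix (Fin 2) (Fin 2) R) (hdet : B.det = 0)
    (i j j' k : Fin 2) : B i j * B k j' = B i j' * B k j := by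
  have hd : B 0 0 * B 1 1 - B 0 1 * B 1 0 = 0 := by rw [← Matrix.det_fin_two]; exact hdet
  fin_cases i <;> fin_cases j <;> fin_cases j' <;> fin_cases k <;> simp <;>
    first
    | ring
    | linear_combination hd
    | linear_combination (-1 : R) * hd

/-- If `det B = 0` and the entry `B i j` is a UNIT, every column of `B` is a multiple of column
`j`: `col_{j'} = (B i j)⁻¹ B i j' · col_j`. [folklore] -/
theorem transpose_apply_eq_smul_of_det_eq_zero (B : Matrix (Fin 2) (Fin 2) R) (hdet : B.det = 0)
    {i j : Fin 2} (hu : IsUnit (B i j)) (j' : Fin 2) :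
    B.transpose j' = (↑hu.unit⁻¹ * B i j') • B.transpose j := by
  ext k
  simp only [Matrix.transpose_apply, Pi.smul_apply, smul_eq_mul]
  have hkey := mul_eq_mul_of_det_fin_two_eq_zero B hdet i j j' k
  have hu1 : (↑hu.unit⁻¹ : R) * B i j = 1 := hu.val_inv_mul
  calc B k j' = (↑hu.unit⁻¹ * B i j) * B k j' := by rw [hu1, one_mul]
    _ = ↑hu.unit⁻¹ * (B i j * B k j') := by ring
    _ = ↑hu.unit⁻¹ * (B i j' * B k j) := by rw [hkey]
    _ = ↑hu.unit⁻¹ * B i j' * B k j := by ring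

/-- **U5 (c): cyclic image.** If `det B = 0` and some entry `B i j` is a unit (for `B = U_ℓ − ε`
at a unipotent-admissible prime: the NON-SCALARITY clause), the column space `range B` is spanned
by the single column `j` — so `coker(U_ℓ − ε)` is the quotient of `(ℤ/pⁿ)²` by a unimodular
vector, i.e. `≅ ℤ/pⁿ` (`nonempty_quot_span_singleton_equiv`), exactly as in Bertolini–Darmon's
`X²/⟨I_f, U_ℓ − ε⟩ ≃ ℤ/pⁿ`. [cite: BertoliniDarmon2005, proof of Thm. 5.15 (p. 48)] -/
theorem range_mulVecLin_eq_span_of_det_eq_zero (B : Matrix (Fin 2) (Fin 2) R) (hdet : B.det = 0)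
    {i j : Fin 2} (hu : IsUnit (B i j)) :
    LinearMap.range B.mulVecLin = Submodule.span R {B.transpose j} := by
  rw [Matrix.range_mulVecLin]
  apply le_antisymm
  · rw [Submodule.span_le]
    rintro _ ⟨j', rfl⟩
    rw [SetLike.mem_coe, Submodule.mem_span_singleton]
    exact ⟨↑hu.unit⁻¹ * B i j', (transpose_apply_eq_smul_of_det_eq_zero B hdet hu j').symm⟩
  · exact Submodule.span_mono (Set.singleton_subset_iff.mpr ⟨j, rfl⟩)

/-- **A unimodular vector of `R²` has quotient `R`**: if `v i` is a unit then
`R² / R·v ≃ R`, via `w ↦ w_{i'} − v_{i'} (v_i)⁻¹ w_i` (`i'` the other index). With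
`range_mulVecLin_eq_span_of_det_eq_zero`: `coker(U_ℓ − ε) ≅ ℤ/pⁿ` at a unipotent-admissible prime.
[folklore] -/
theorem nonempty_quot_span_singleton_equiv (v : Fin 2 → R) (i : Fin 2) (hu : IsUnit (v i)) :
    Nonempty (((Fin 2 → R) ⧸ Submodule.span R {v}) ≃ₗ[R] R) := by
  classical
  obtain ⟨i', hii'⟩ : ∃ i' : Fin 2, i' ≠ i := ⟨i + 1, by fin_cases i <;> decide⟩
  have hcov : ∀ k : Fin 2, k = i ∨ k = i' := by
    intro k; fin_cases i <;> fin_cases i' <;> fin_cases k <;> simp_all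
  let φ : (Fin 2 → R) →ₗ[R] R :=
    LinearMap.proj i' - (v i' * ↑hu.unit⁻¹) • LinearMap.proj i
  have hφ : ∀ w : Fin 2 → R, φ w = w i' - v i' * ↑hu.unit⁻¹ * w i := by
    intro w; simp [φ, mul_assoc]
  have hu1 : (↑hu.unit⁻¹ : R) * v i = 1 := hu.val_inv_mul
  have hφv : φ v = 0 := by
    rw [hφ]
    calc v i' - v i' * ↑hu.unit⁻¹ * v i = v i' - v i' * (↑hu.unit⁻¹ * v i) := by ring
      _ = 0 := by rw [hu1, mul_one, sub_self]
  have hsurj : Function.Surjective φ := by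
    intro r
    refine ⟨Pi.single i' r, ?_⟩
    rw [hφ, Pi.single_eq_same, Pi.single_eq_of_ne hii'.symm, mul_zero, sub_zero]
  have hker : LinearMap.ker φ = Submodule.span R {v} := by
    apply le_antisymm
    · intro w hw
      rw [LinearMap.mem_ker, hφ, sub_eq_zero] at hw
      rw [Submodule.mem_span_singleton]
      refine ⟨w i * ↑hu.unit⁻¹, ?_⟩
      ext k
      rcases hcov k with rfl | rfl
      · simp only [Pi.smul_apply, smul_eq_mul]
        calc w k * ↑hu.unit⁻¹ * v k = w k * (↑hu.unit⁻¹ * v k) := by ring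
          _ = w k := by rw [hu1, mul_one]
      · simp only [Pi.smul_apply, smul_eq_mul]
        rw [hw]; ring
    · rw [Submodule.span_le, Set.singleton_subset_iff, SetLike.mem_coe, LinearMap.mem_ker]
      exact hφv
  exact ⟨(Submodule.quotEquivOfEq _ _ hker.symm).trans (LinearMap.quotKerEquivOfSurjective φ hsurj)⟩

end HeckeModule

end Summit.BirchSwinnertonDyer.Rank1Residual.X11b.Three.UAdm
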